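import Mathlib
import Summits.KontsevichZagierPeriods.Zeta5Search.SecondOrderRaise
import HarnessLib

/-!
# ζ(5) search — gen-2 g10's RAISE LEMMA, pair form: `σ(S) + σ(S^rev) = τ(T)` (tools for THEOREM A‴ / `LawA3`)

Cell `pub-zeta5` (HONEST FRAMING: systematic search; no irrationality claim unless certified), typer seat generation 11.
REPORT-gen2-g10 §2.2 (R1)–(R2): for a PALINDROMIC type `T = (L, e)` (`e_{L−k} = e_k`) and a single raise `S` of `T` in the sense of
`SecondOrder.isRaise` (raise at an existing level, or a new end point `1 :: T` / `T ++ [1]`), the reversal `S^rev` is again a single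
raise of `T` and the first-digit functionals of the pair add up to the second-order direction of `T`:
`ŵ(S) + ŵ(S^rev) = τ_W(T)` (`typeW_raise_pair`) and `v̂(S) + v̂(S^rev) = τ_V(T) + [new end point]·corr(T)` (`typeV_raise_pair`;
`corr(T) = typeCorr`, the translation term of `typeV_consOne`, vanishes for realised types of negative degree — shown where used).
Assembled from `typeW/V_raiseAt`, `typeW/V_snocOne`, `typeW/V_consOne` of `SecondOrderRaise.lean`.  Nothing here bears on irrationality.
-/

noncomputable section

open Finset PowerSeries

namespace Summit.KontsevichZagierPeriods.Zeta5Search.SecondOrder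

open Summit.KontsevichZagierPeriods.Zeta5Search.LevelClass (typeRho typeW typeV typeExp typeW_congr typeV_congr)

/-! ## §5 The raise lemma for the pair `{S, S^rev}` -/

/-- **RAISE LEMMA, `W`-component**: for a palindromic type `T` and a single raise `S` of `T`, the `ŵ`-functionals of `S` and of its
reversal add up to `τ_W(T)` (the translation term is absent for `ŵ`). -/
theorem typeW_raise_pair {L M : ℕ} {e f : ℕ → ℤ} (hpal : ∀ k ≤ L, e (L - k) = e k)
    (h : isRaise ((List.range (L + 1)).map e) ((List.range (M + 1)).map f) = true) :
    typeW M f + typeW M (fun k => f (M - k)) = typeTauW L e := by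
  rcases isRaise_level h with ⟨k, hk, hML, hf⟩ | ⟨hML, hf⟩ | ⟨hML, hf⟩
  · subst hML
    have h1 : typeW M f = typeW M (raiseAt e k) := typeW_congr hf
    have h2 : typeW M (fun j => f (M - j)) = typeW M (raiseAt e (M - k)) := by
      refine typeW_congr fun j hj => ?_
      show f (M - j) = raiseAt e (M - k) j
      rw [hf (M - j) (by omega), raiseAt, raiseAt, hpal j hj]
      by_cases hjk : j = M - k
      · rw [if_pos (by omega), if_pos hjk]
      · rw [if_neg (by omega), if_neg hjk]
    rw [h1, h2, typeW_raiseAt e hk, typeW_raiseAt e (by omega : M - k ≤ M), typeTauW]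
    push_cast [Nat.cast_sub hk]
    ring
  · subst hML
    have h1 : typeW (L + 1) f = typeW (L + 1) (consOne e) := typeW_congr hf
    have h2 : typeW (L + 1) (fun j => f (L + 1 - j)) = typeW (L + 1) (snocOne e L) := by
      refine typeW_congr fun j hj => ?_
      show f (L + 1 - j) = snocOne e L j
      rw [hf (L + 1 - j) (by omega), consOne, snocOne]
      by_cases hj0 : j = L + 1
      · rw [if_pos (by omega), if_pos hj0]
      · rw [if_neg (by omega), if_neg hj0, ← hpal j (by omega)]
        congr 1; omega
    rw [h1, h2, typeW_consOne, typeW_snocOne, typeTauW]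
    push_cast
    ring
  · subst hML
    have h1 : typeW (L + 1) f = typeW (L + 1) (snocOne e L) := typeW_congr hf
    have h2 : typeW (L + 1) (fun j => f (L + 1 - j)) = typeW (L + 1) (consOne e) := by
      refine typeW_congr fun j hj => ?_
      show f (L + 1 - j) = consOne e j
      rw [hf (L + 1 - j) (by omega), consOne, snocOne]
      by_cases hj0 : j = 0
      · rw [if_pos (by omega), if_pos hj0]
      · rw [if_neg (by omega), if_neg hj0, ← hpal (j - 1) (by omega)]
        congr 1; omega
    rw [h1, h2, typeW_consOne, typeW_snocOne, typeTauW]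
    push_cast
    ring

/-- **RAISE LEMMA, `V`-component** (with the translation term made explicit): for a palindromic `T` and a single raise `S`,
`v̂(S) + v̂(S^rev) = τ_V(T) + [S or S^rev is 1 :: T]·corr(T)`. -/
theorem typeV_raise_pair {L M : ℕ} {e f : ℕ → ℤ} (hpal : ∀ k ≤ L, e (L - k) = e k)
    (h : isRaise ((List.range (L + 1)).map e) ((List.range (M + 1)).map f) = true) :
    typeV M f + typeV M (fun k => f (M - k)) = typeTauV L e + (if M = L + 1 then typeCorr L e else 0) := by
  rcases isRaise_level h with ⟨k, hk, hML, hf⟩ | ⟨hML, hf⟩ | ⟨hML, hf⟩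
  · subst hML
    have h1 : typeV M f = typeV M (raiseAt e k) := typeV_congr hf
    have h2 : typeV M (fun j => f (M - j)) = typeV M (raiseAt e (M - k)) := by
      refine typeV_congr fun j hj => ?_
      show f (M - j) = raiseAt e (M - k) j
      rw [hf (M - j) (by omega), raiseAt, raiseAt, hpal j hj]
      by_cases hjk : j = M - k
      · rw [if_pos (by omega), if_pos hjk]
      · rw [if_neg (by omega), if_neg hjk]
    rw [h1, h2, typeV_raiseAt e hk, typeV_raiseAt e (by omega : M - k ≤ M), typeTauV, if_neg (by omega)]
    push_cast [Nat.cast_sub hk]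
    ring
  · subst hML
    have h1 : typeV (L + 1) f = typeV (L + 1) (consOne e) := typeV_congr hf
    have h2 : typeV (L + 1) (fun j => f (L + 1 - j)) = typeV (L + 1) (snocOne e L) := by
      refine typeV_congr fun j hj => ?_
      show f (L + 1 - j) = snocOne e L j
      rw [hf (L + 1 - j) (by omega), consOne, snocOne]
      by_cases hj0 : j = L + 1
      · rw [if_pos (by omega), if_pos hj0]
      · rw [if_neg (by omega), if_neg hj0, ← hpal j (by omega)]
        congr 1; omega
    rw [h1, h2, typeV_consOne, typeV_snocOne, typeTauV, if_pos rfl]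
    push_cast
    ring
  · subst hML
    have h1 : typeV (L + 1) f = typeV (L + 1) (snocOne e L) := typeV_congr hf
    have h2 : typeV (L + 1) (fun j => f (L + 1 - j)) = typeV (L + 1) (consOne e) := by
      refine typeV_congr fun j hj => ?_
      show f (L + 1 - j) = consOne e j
      rw [hf (L + 1 - j) (by omega), consOne, snocOne]
      by_cases hj0 : j = 0
      · rw [if_pos (by omega), if_pos hj0]
      · rw [if_neg (by omega), if_neg hj0, ← hpal (j - 1) (by omega)]
        congr 1; omega
    rw [h1, h2, typeV_consOne, typeV_snocOne, typeTauV, if_pos rfl]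
    push_cast
    ring

end Summit.KontsevichZagierPeriods.Zeta5Search.SecondOrder

end
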